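import Mathlib
import HarnessLib
import Summits.ValiantsHypothesis.ValiantsHypothesis.Theorems.KPlusLogSqLawWeakLiftingTowerGraftWronskianDevelopable
import Summits.ValiantsHypothesis.ValiantsHypothesis.Theorems.SymmetroidPencilBasics

/-!
# Tower graft line — CONJECTURE W IS ATTAINED AT `K = 4`: four positive Wronskian zeros on the 2-tower `(0,1,3,20)` and on the
# balanced support `(0,1,3,4)` (exact there), in the kernel

Helper file for LINE (B) `Cruxes/WeakLifting/Lines/tower_graft.lean` (crux `WeakLifting` = stmt-ValiantsHypothesis-19561), calibrating
hand g9's CONJECTURE W «`Z₊(W(u,v)) ≤ 2K − 4`» (`…InflectionLawSizeOne` §2; = the `k = 1` developable conjecture of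
[cite: SedykhShapiro2005] on lacunary moment arcs, `…WronskianDevelopable`).  NO stub is claimed.

* `four_le_card_posRoots_wronskian_tower` — on the 2-TOWER `d = (0,1,3,20)` (the first support NOT decided by Descartes: six distinct
  pair sums, rank-one ceiling `C(4,2) − 1 = 5`) the integer `4`-nomials `u = 5 − 4X + X³ − 2X²⁰`, `v = −3 + 2X + X³ − 3X²⁰` have
  `W(u,v) = −2 + 24X² − 12X³ − 420X¹⁹ + 304X²⁰ − 17X²²` (`wronskian_tower_witness_eq`) with FOUR positive zeros, certified by the
  sign alternation `−,+,−,+,−` at `1/8 < 1/2 < 1 < 2 < 4` (`norm_num` + the tree's `le_card_posRoots_of_alternating`).  So the conjectured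
  `2K − 4 = 4` is ATTAINED on a tower at `K = 4`: no bound below `2K − 4` holds there (`not_wronskian_bound_three_tower`), and the truth
  on this support is `4` or `5` (`card_posRoots_wronskian_tower_witness_mem`).
* `card_posRoots_wronskian_balanced_witness` — on the BALANCED support `d = (0,1,3,4)` the integer `4`-nomials `u = −4 + 3X + 4X³ − 3X⁴`,
  `v = 1 − X + 3X³ − 2X⁴` have `W(u,v) = 1 − 48X² + 70X³ − 27X⁴ + X⁶` with EXACTLY four positive zeros (`≥ 4` by the alternation
  `+,−,+,−,+` at `1/16 < 1/2 < 3/2 < 5/2 < 4`; `≤ 4` by `…WronskianDevelopable.card_posRoots_wronskian_le_four_of_balanced`): the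
  balanced-chamber bound is sharp.

HONEST FRAMING: two explicit integer pencils, exact arithmetic; calibration only (lower bounds for the conjectured `2K − 4` at `K = 4`);
Conjecture W is NOT proved; nothing on S4/S4b/S4d/S4f/S5/S5ᴸ, TowerB, `WeakLifting`, Conjecture B, `MatrixDescartes` (18050) or
`VP ≠ VNP`.  Def-free.  Seat: prover leafhand-val-kpluslogsqlaw-1 g10, `--supports stmt-ValiantsHypothesis-19561 --as helper`.
[folklore: intermediate value theorem certificates; the witnesses (integer search, `scratch/w4search.py`, `w4bal.py`) are this work]
-/

-- `Summit.ValiantsHypothesis.ValiantsHypothesis.…` repeats a component by the D-0017 layout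
-- (single-conjunct summit), which the `dupNamespace` linter flags; the name is mandated.
set_option linter.dupNamespace false
set_option autoImplicit false

namespace Summit.ValiantsHypothesis.ValiantsHypothesis.Theorems.KPlusLogSqLaw.TowerGraft

open Polynomial Finset
open scoped BigOperators Polynomial
open Summit.ValiantsHypothesis.ValiantsHypothesis.Theorems.SymmetroidDescartes (le_card_posRoots_of_alternating)

namespace WronskianDevelopable

/-! ## §1 The 2-tower `(0,1,3,20)`: four positive Wronskian zeros (Descartes allows five, Conjecture W predicts four) -/

/-- the tower witness in fewnomial form is the explicit pair `u = 5 − 4X + X³ − 2X²⁰`, `v = −3 + 2X + X³ − 3X²⁰`. [this work] -/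
theorem tower_witness_u_eq :
    (∑ l : Fin 4, C ((![5, -4, 1, -2] : Fin 4 → ℝ) l) * (X : ℝ[X]) ^ ((![0, 1, 3, 20] : Fin 4 → ℕ) l)) =
      C 5 - C 4 * X + X ^ 3 - C 2 * X ^ 20 := by
  simp [Fin.sum_univ_four, Matrix.cons_val]
  ring

/-- the second tower witness fewnomial `v = −3 + 2X + X³ − 3X²⁰`. [this work] -/
theorem tower_witness_v_eq :
    (∑ l : Fin 4, C ((![-3, 2, 1, -3] : Fin 4 → ℝ) l) * (X : ℝ[X]) ^ ((![0, 1, 3, 20] : Fin 4 → ℕ) l)) =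
      -C 3 + C 2 * X + X ^ 3 - C 3 * X ^ 20 := by
  simp [Fin.sum_univ_four, Matrix.cons_val]
  ring

/-- **closed form of the tower witness Wronskian**: `W(u,v) = −2 + 24X² − 12X³ − 420X¹⁹ + 304X²⁰ − 17X²²` (six monomials, fully
alternating signs — Descartes' ceiling `5` is not excluded by signs). [this work] -/
theorem wronskian_tower_witness_eq :
    wronskian (C 5 - C 4 * X + X ^ 3 - C 2 * X ^ 20 : ℝ[X]) (-C 3 + C 2 * X + X ^ 3 - C 3 * X ^ 20) =
      -C 2 + C 24 * X ^ 2 - C 12 * X ^ 3 - C 420 * X ^ 19 + C 304 * X ^ 20 - C 17 * X ^ 22 := by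
  simp only [wronskian, derivative_sub, derivative_add, derivative_neg, derivative_mul, derivative_X,
    derivative_X_pow, Nat.cast_ofNat, map_ofNat, mul_one]
  norm_num
  ring

/-- evaluation of the tower witness Wronskian. [this work] -/
theorem eval_wronskian_tower_witness (t : ℝ) :
    (wronskian (C 5 - C 4 * X + X ^ 3 - C 2 * X ^ 20 : ℝ[X]) (-C 3 + C 2 * X + X ^ 3 - C 3 * X ^ 20)).eval t =
      -2 + 24 * t ^ 2 - 12 * t ^ 3 - 420 * t ^ 19 + 304 * t ^ 20 - 17 * t ^ 22 := by
  rw [wronskian_tower_witness_eq]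
  simp [eval_add, eval_sub, eval_mul, eval_pow, eval_C, eval_X, eval_neg]

/-- **FOUR positive zeros on the 2-tower `(0,1,3,20)`** — sign alternation `−,+,−,+,−` at `1/8 < 1/2 < 1 < 2 < 4`. [this work] -/
theorem four_le_card_posRoots_wronskian_tower :
    4 ≤ ((wronskian (C 5 - C 4 * X + X ^ 3 - C 2 * X ^ 20 : ℝ[X]) (-C 3 + C 2 * X + X ^ 3 - C 3 * X ^ 20)).roots.toFinset.filter
      (fun t => 0 < t)).card := by
  refine le_card_posRoots_of_alternating _ 4 (![1/8, 1/2, 1, 2, 4] : Fin 5 → ℝ) ?_ ?_ ?_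
  · refine Fin.strictMono_iff_lt_succ.2 fun j => ?_
    fin_cases j <;> simp only [Fin.castSucc_mk, Fin.succ_mk] <;> norm_num
  · intro j; fin_cases j <;> norm_num
  · intro j
    fin_cases j <;> simp only [Fin.castSucc_mk, Fin.succ_mk, eval_wronskian_tower_witness] <;> norm_num

/-- the same count in the fewnomial currency of `…WronskianDevelopable` / `…InflectionLawSizeOne` (support `d = (0,1,3,20)`,
coefficient vectors `u = (5,−4,1,−2)`, `v = (−3,2,1,−3)`). [this work] -/
theorem four_le_card_posRoots_wronskian_tower_fewnomial :
    4 ≤ ((wronskian (∑ l : Fin 4, C ((![5, -4, 1, -2] : Fin 4 → ℝ) l) * (X : ℝ[X]) ^ ((![0, 1, 3, 20] : Fin 4 → ℕ) l))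
      (∑ l : Fin 4, C ((![-3, 2, 1, -3] : Fin 4 → ℝ) l) * (X : ℝ[X]) ^ ((![0, 1, 3, 20] : Fin 4 → ℕ) l))).roots.toFinset.filter
      (fun t => 0 < t)).card := by
  rw [tower_witness_u_eq, tower_witness_v_eq]
  exact four_le_card_posRoots_wronskian_tower

/-- **the truth on this tower is `4` or `5`**: `4 ≤ Z₊ ≤ C(4,2) − 1 = 5` (rank-one Descartes ceiling of `…InflectionLawSizeOne`);
Conjecture W (= Theorem A's count for closed convex curves in `P³` [cite: SedykhShapiro2005, Thm A]) predicts `4`. [this work] -/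
theorem card_posRoots_wronskian_tower_witness_mem :
    ((wronskian (∑ l : Fin 4, C ((![5, -4, 1, -2] : Fin 4 → ℝ) l) * (X : ℝ[X]) ^ ((![0, 1, 3, 20] : Fin 4 → ℕ) l))
      (∑ l : Fin 4, C ((![-3, 2, 1, -3] : Fin 4 → ℝ) l) * (X : ℝ[X]) ^ ((![0, 1, 3, 20] : Fin 4 → ℕ) l))).roots.toFinset.filter
      (fun t => 0 < t)).card ∈ ({4, 5} : Finset ℕ) := by
  have h4 := four_le_card_posRoots_wronskian_tower_fewnomial
  have h5 := InflectionLaw.card_posRoots_wronskian_fewnomial_le_choose (![5, -4, 1, -2] : Fin 4 → ℝ)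
    (![-3, 2, 1, -3] : Fin 4 → ℝ) (![0, 1, 3, 20] : Fin 4 → ℕ)
  have h5' : ((wronskian (∑ l : Fin 4, C ((![5, -4, 1, -2] : Fin 4 → ℝ) l) * (X : ℝ[X]) ^ ((![0, 1, 3, 20] : Fin 4 → ℕ) l))
      (∑ l : Fin 4, C ((![-3, 2, 1, -3] : Fin 4 → ℝ) l) * (X : ℝ[X]) ^ ((![0, 1, 3, 20] : Fin 4 → ℕ) l))).roots.toFinset.filter
      (fun t => 0 < t)).card ≤ 5 := by
    convert h5 using 1
    decide
  rw [Finset.mem_insert, Finset.mem_singleton]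
  omega

/-- **no bound below `2K − 4` on towers**: «`Z₊(W(u,v)) ≤ 3` for all `4`-nomials on `(0,1,3,20)`» is FALSE (so neither `K − 1 = 3`
nor any sub-`(2K−4)` law survives the first tower). [this work] -/
theorem not_wronskian_bound_three_tower :
    ¬ ∀ u v : Fin 4 → ℝ, ((wronskian (∑ l : Fin 4, C (u l) * (X : ℝ[X]) ^ ((![0, 1, 3, 20] : Fin 4 → ℕ) l))
      (∑ l : Fin 4, C (v l) * (X : ℝ[X]) ^ ((![0, 1, 3, 20] : Fin 4 → ℕ) l))).roots.toFinset.filter (fun t => 0 < t)).card ≤ 3 := by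
  intro h
  have h4 := four_le_card_posRoots_wronskian_tower_fewnomial
  have h3 := h (![5, -4, 1, -2]) (![-3, 2, 1, -3])
  omega

/-! ## §2 The balanced support `(0,1,3,4)`: exactly four positive Wronskian zeros -/

/-- the balanced witness fewnomial `u = −4 + 3X + 4X³ − 3X⁴` on `(0,1,3,4)`. [this work] -/
theorem balanced_witness_u_eq :
    (∑ l : Fin 4, C ((![-4, 3, 4, -3] : Fin 4 → ℝ) l) * (X : ℝ[X]) ^ ((![0, 1, 3, 4] : Fin 4 → ℕ) l)) =
      -C 4 + C 3 * X + C 4 * X ^ 3 - C 3 * X ^ 4 := by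
  simp [Fin.sum_univ_four, Matrix.cons_val]
  ring

/-- the balanced witness fewnomial `v = 1 − X + 3X³ − 2X⁴` on `(0,1,3,4)`. [this work] -/
theorem balanced_witness_v_eq :
    (∑ l : Fin 4, C ((![1, -1, 3, -2] : Fin 4 → ℝ) l) * (X : ℝ[X]) ^ ((![0, 1, 3, 4] : Fin 4 → ℕ) l)) =
      C 1 - X + C 3 * X ^ 3 - C 2 * X ^ 4 := by
  simp [Fin.sum_univ_four, Matrix.cons_val]
  ring

/-- **closed form of the balanced witness Wronskian**: `W(u,v) = 1 − 48X² + 70X³ − 27X⁴ + X⁶` (the pair sums `0+4 = 1+3` merge: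
five monomials). [this work] -/
theorem wronskian_balanced_witness_eq :
    wronskian (-C 4 + C 3 * X + C 4 * X ^ 3 - C 3 * X ^ 4 : ℝ[X]) (C 1 - X + C 3 * X ^ 3 - C 2 * X ^ 4) =
      C 1 - C 48 * X ^ 2 + C 70 * X ^ 3 - C 27 * X ^ 4 + X ^ 6 := by
  simp only [wronskian, derivative_sub, derivative_add, derivative_neg, derivative_mul, derivative_X,
    derivative_X_pow, Nat.cast_ofNat, map_ofNat, mul_one]
  norm_num
  ring

/-- evaluation of the balanced witness Wronskian. [this work] -/
theorem eval_wronskian_balanced_witness (t : ℝ) :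
    (wronskian (-C 4 + C 3 * X + C 4 * X ^ 3 - C 3 * X ^ 4 : ℝ[X]) (C 1 - X + C 3 * X ^ 3 - C 2 * X ^ 4)).eval t =
      1 - 48 * t ^ 2 + 70 * t ^ 3 - 27 * t ^ 4 + t ^ 6 := by
  rw [wronskian_balanced_witness_eq]
  simp [eval_add, eval_sub, eval_mul, eval_pow, eval_C, eval_X]

/-- four positive zeros on the balanced support — sign alternation `+,−,+,−,+` at `1/16 < 1/2 < 3/2 < 5/2 < 4`. [this work] -/
theorem four_le_card_posRoots_wronskian_balanced :
    4 ≤ ((wronskian (-C 4 + C 3 * X + C 4 * X ^ 3 - C 3 * X ^ 4 : ℝ[X]) (C 1 - X + C 3 * X ^ 3 - C 2 * X ^ 4)).roots.toFinset.filter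
      (fun t => 0 < t)).card := by
  refine le_card_posRoots_of_alternating _ 4 (![1/16, 1/2, 3/2, 5/2, 4] : Fin 5 → ℝ) ?_ ?_ ?_
  · refine Fin.strictMono_iff_lt_succ.2 fun j => ?_
    fin_cases j <;> simp only [Fin.castSucc_mk, Fin.succ_mk] <;> norm_num
  · intro j; fin_cases j <;> norm_num
  · intro j
    fin_cases j <;> simp only [Fin.castSucc_mk, Fin.succ_mk, eval_wronskian_balanced_witness] <;> norm_num

/-- **EXACTLY four on the balanced support `(0,1,3,4)`**: `≥ 4` by the certificate, `≤ 4` by the balanced chamber of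
`…WronskianDevelopable` — Conjecture W's bound `2K − 4` is attained AND proved on this support. [this work] -/
theorem card_posRoots_wronskian_balanced_witness :
    ((wronskian (∑ l : Fin 4, C ((![-4, 3, 4, -3] : Fin 4 → ℝ) l) * (X : ℝ[X]) ^ ((![0, 1, 3, 4] : Fin 4 → ℕ) l))
      (∑ l : Fin 4, C ((![1, -1, 3, -2] : Fin 4 → ℝ) l) * (X : ℝ[X]) ^ ((![0, 1, 3, 4] : Fin 4 → ℕ) l))).roots.toFinset.filter
      (fun t => 0 < t)).card = 4 := by
  have hle := card_posRoots_wronskian_le_four_of_balanced (![-4, 3, 4, -3] : Fin 4 → ℝ) (![1, -1, 3, -2] : Fin 4 → ℝ)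
    (![0, 1, 3, 4] : Fin 4 → ℕ) (by simp)
  have hge : 4 ≤ ((wronskian (∑ l : Fin 4, C ((![-4, 3, 4, -3] : Fin 4 → ℝ) l) * (X : ℝ[X]) ^ ((![0, 1, 3, 4] : Fin 4 → ℕ) l))
      (∑ l : Fin 4, C ((![1, -1, 3, -2] : Fin 4 → ℝ) l) * (X : ℝ[X]) ^ ((![0, 1, 3, 4] : Fin 4 → ℕ) l))).roots.toFinset.filter
      (fun t => 0 < t)).card := by
    rw [balanced_witness_u_eq, balanced_witness_v_eq]
    exact four_le_card_posRoots_wronskian_balanced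
  exact le_antisymm hle hge

end WronskianDevelopable

end Summit.ValiantsHypothesis.ValiantsHypothesis.Theorems.KPlusLogSqLaw.TowerGraft
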